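import Literature.Geometry.Riemannian.LocalIsometryTransport
import HarnessLib

/-!
# Gluing a model metric into a Riemannian manifold along an injective immersion

Topic `Geometry/Riemannian`. The last constructive step of Weinstein's surgery (Weinstein 1968,
proof of the main theorem, step (3): "modify the metric in the interior of the disk `D`"): let
`Ψ : E → M` be a `C^∞` injective immersion of an open set `D ⊆ E` (the polar chart of the disk
composed with the tube map), `P` a `C^∞` symmetric positive definite field of bilinear forms on `D`
(the polar metric of `SurgeryPolarMetric.lean`), and suppose `P = Ψ^* g₀` off a closed set
`S' ⊆ S`, `S` open with compact closure `S̄ ⊆ D`. Then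

* `exists_glued_metric` — **there is a `C^∞` metric `g₁` on `M` with `Ψ^* g₁ = P` on `D`,
  `g₁ = g₀` off `Ψ(S)`, Riemannian if `g₀` is.**

`g₁` is the push-forward of `P` on `Ψ(S)` and `g₀` elsewhere; the two definitions agree on
`Ψ(S ∖ S')`. Smoothness inside `Ψ(S)` descends along the local diffeomorphism `Ψ`
(`contMDiffAt_of_pullbackBilin_eq`); at the other points `g₁ = g₀` locally (compactness of
`Ψ(S̄)` and the inverse function theorem at the points of `Ψ(S̄ ∖ S)`).

## References

* A. Weinstein, Ann. of Math. (2) 87 (1968), 29–41, proof of the main theorem, step (3).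
  [cite: Weinstein1968]
* B. O'Neill, *Semi-Riemannian Geometry* (1983), Ch. 3, pp. 90–91. [cite: ONeill1983, Ch. 3, pp. 90–91]

Tags: [Surgery] [Weinstein1968]
-/

noncomputable section

open Bundle Set Function Filter TopologicalSpace Metric Module
open scoped Manifold ContDiff Topology

namespace Literature.Geometry.Riemannian

open Literature.Geometry.Lorentzian
open Literature.Geometry.Lorentzian.OpensChart
open Literature.Geometry.Lorentzian.PseudoRiemannianMetric

variable {E : Type*} [NormedAddCommGroup E] [NormedSpace ℝ E] [FiniteDimensional ℝ E]
  [CompleteSpace E] {H : Type*} [TopologicalSpace H] {I : ModelWithCorners ℝ E H} [I.Boundaryless]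
  {M : Type*} [TopologicalSpace M] [ChartedSpace H M] [IsManifold I ∞ M] [T2Space M]
  (g₀ : PseudoRiemannianMetric I ∞ E (TangentSpace I : M → Type _))

set_option maxHeartbeats 3200000 in
/-- **Gluing a model metric along an injective immersion.** See the module docstring.
[cite: Weinstein1968, proof of the main theorem, step (3)] -/
theorem exists_glued_metric {Ψ : E → M} {D S S' : Set E} {P : E → E →L[ℝ] E →L[ℝ] ℝ}
    (hD : IsOpen D) (hS : IsOpen S) (hSD : closure S ⊆ D) (hSc : IsCompact (closure S))
    (hS'S : S' ⊆ S) (hS' : IsClosed S')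
    (hΨs : ContMDiffOn 𝓘(ℝ, E) I ∞ Ψ D) (hΨinj : InjOn Ψ D)
    (hΨd : ∀ x ∈ D, Injective (mfderiv 𝓘(ℝ, E) I Ψ x))
    (hPs : ContDiffOn ℝ ∞ P D) (hPsymm : ∀ x ∈ D, ∀ a b : E, P x a b = P x b a)
    (hPpos : ∀ x ∈ D, ∀ a : E, a ≠ 0 → 0 < P x a a)
    (hPeq : ∀ x ∈ D, x ∉ S' → ∀ a b : E,
      P x a b = g₀.val (Ψ x) (mfderiv 𝓘(ℝ, E) I Ψ x a) (mfderiv 𝓘(ℝ, E) I Ψ x b)) :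
    ∃ g₁ : PseudoRiemannianMetric I ∞ E (TangentSpace I : M → Type _),
      (∀ x ∈ D, ∀ a b : E,
        g₁.val (Ψ x) (mfderiv 𝓘(ℝ, E) I Ψ x a) (mfderiv 𝓘(ℝ, E) I Ψ x b) = P x a b) ∧
      (∀ y : M, y ∉ Ψ '' S → g₁.val y = g₀.val y) ∧
      (g₀.IsRiemannian → g₁.IsRiemannian) := by
  classical
  have hSD' : S ⊆ D := subset_closure.trans hSD
  /- ── the differential as an equivalence, and the push-forward form ── -/
  have hbij : ∀ x ∈ D, Bijective (mfderiv 𝓘(ℝ, E) I Ψ x) := fun x hx ↦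
    mfderiv_bijective_of_injective (I := I) (I' := 𝓘(ℝ, E)) (hΨd x hx) rfl
  -- a total choice of "inverse differential" (junk off `D`)
  -- the differential read as a map `E →L E`
  set T : E → (E →L[ℝ] E) := fun x ↦ (mfderiv 𝓘(ℝ, E) I Ψ x : E →L[ℝ] E) with hTdef
  have hT : ∀ x (a : E), T x a = mfderiv 𝓘(ℝ, E) I Ψ x a := fun x a ↦ rfl
  have hTbij : ∀ x ∈ D, Bijective (T x) := fun x hx ↦ hbij x hx
  set Q : E → (E →L[ℝ] E) := fun x ↦
    if hx : x ∈ D then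
      ((ContinuousLinearEquiv.ofBijective (T x)
        (LinearMap.ker_eq_bot.2 (hTbij x hx).1) (LinearMap.range_eq_top.2 (hTbij x hx).2)).symm :
          E →L[ℝ] E)
    else ContinuousLinearMap.id ℝ E with hQdef
  have hQ : ∀ x ∈ D, ∀ a : E, Q x (mfderiv 𝓘(ℝ, E) I Ψ x a) = a := by
    intro x hx a
    rw [← hT]
    simp only [hQdef, dif_pos hx]
    exact ContinuousLinearEquiv.ofBijective_symm_apply_apply (T x) _ _ a
  have hQ' : ∀ x ∈ D, ∀ X : E, mfderiv 𝓘(ℝ, E) I Ψ x (Q x X) = X := by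
    intro x hx X
    rw [← hT]
    simp only [hQdef, dif_pos hx]
    exact ContinuousLinearEquiv.ofBijective_apply_symm_apply (T x) _ _ X
  have hQinj : ∀ x ∈ D, Injective (Q x) := by
    intro x hx a b hab
    have h1 := hQ' x hx a
    have h2 := hQ' x hx b
    rw [hab] at h1
    exact h1.symm.trans h2
  set push : E → (E →L[ℝ] E →L[ℝ] ℝ) := fun x ↦ (((P x).comp (Q x)).flip.comp (Q x)).flip
    with hpushdef
  have hpush : ∀ x (X Y : E), push x X Y = P x (Q x X) (Q x Y) := fun x X Y ↦ rfl
  /- ── the modified region and the preimage map ── -/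
  set O : Set M := Ψ '' S with hO
  set pre : M → E := invFunOn Ψ S with hpre
  have hpreS : ∀ y ∈ O, pre y ∈ S := fun y hy ↦ invFunOn_mem (by simpa [hO] using hy)
  have hpreΨ : ∀ y ∈ O, Ψ (pre y) = y := fun y hy ↦ invFunOn_eq (by simpa [hO] using hy)
  have hpre_of : ∀ x ∈ S, pre (Ψ x) = x := by
    intro x hx
    have hy : Ψ x ∈ O := ⟨x, hx, rfl⟩
    exact hΨinj (hSD' (hpreS _ hy)) (hSD' hx) (hpreΨ _ hy)
  /- ── the glued field ── -/
  set val₁ : Π y : M, TangentSpace I y →L[ℝ] TangentSpace I y →L[ℝ] ℝ := fun y ↦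
    if y ∈ O then push (pre y) else g₀.val y with hval₁
  have hval_in : ∀ y ∈ O, val₁ y = push (pre y) := fun y hy ↦ by simp only [hval₁, if_pos hy]
  have hval_out : ∀ y, y ∉ O → val₁ y = g₀.val y := fun y hy ↦ by simp only [hval₁, if_neg hy]
  -- the key identity on `S`
  have hkeyS : ∀ x ∈ S, ∀ a b : E,
      val₁ (Ψ x) (mfderiv 𝓘(ℝ, E) I Ψ x a) (mfderiv 𝓘(ℝ, E) I Ψ x b) = P x a b := by
    intro x hx a b
    have hy : Ψ x ∈ O := ⟨x, hx, rfl⟩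
    rw [hval_in _ hy, hpre_of x hx]
    show P x (Q x (mfderiv 𝓘(ℝ, E) I Ψ x a)) (Q x (mfderiv 𝓘(ℝ, E) I Ψ x b)) = P x a b
    rw [hQ x (hSD' hx), hQ x (hSD' hx)]
  -- points of `D ∖ S` are not mapped into `O`
  have hnotO : ∀ x ∈ D, x ∉ S → Ψ x ∉ O := by
    rintro x hx hxS ⟨x', hx', he⟩
    exact hxS (hΨinj (hSD' hx') hx he ▸ hx')
  have hkey : ∀ x ∈ D, ∀ a b : E,
      val₁ (Ψ x) (mfderiv 𝓘(ℝ, E) I Ψ x a) (mfderiv 𝓘(ℝ, E) I Ψ x b) = P x a b := by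
    intro x hx a b
    by_cases hxS : x ∈ S
    · exact hkeyS x hxS a b
    · rw [hval_out _ (hnotO x hx hxS), hPeq x hx (fun h ↦ hxS (hS'S h))]
  -- on `O ∩ Ψ(D ∖ S')` the push-forward is `g₀`
  have hpush_g₀ : ∀ x ∈ D, x ∉ S' → push x = g₀.val (Ψ x) := by
    intro x hx hxS'
    ext X Y
    rw [hpush, hPeq x hx hxS', hQ' x hx, hQ' x hx]
    rfl
  /- ── symmetry and positivity ── -/
  have hsymm : ∀ y (v w : TangentSpace I y), val₁ y v w = val₁ y w v := by
    intro y v w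
    by_cases hy : y ∈ O
    · rw [hval_in y hy]
      show P (pre y) (Q (pre y) v) (Q (pre y) w) = P (pre y) (Q (pre y) w) (Q (pre y) v)
      exact hPsymm _ (hSD' (hpreS y hy)) _ _
    · rw [hval_out y hy]; exact g₀.symm y v w
  have hposO : ∀ y ∈ O, ∀ v : TangentSpace I y, v ≠ 0 → 0 < val₁ y v v := by
    intro y hy v hv
    rw [hval_in y hy]
    show 0 < P (pre y) (Q (pre y) v) (Q (pre y) v)
    have hxD := hSD' (hpreS y hy)
    exact hPpos _ hxD _ (fun h0 ↦ hv (hQinj _ hxD (h0.trans (map_zero (Q (pre y))).symm)))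
  have hnondeg : ∀ y (v : TangentSpace I y), (∀ w, val₁ y v w = 0) → v = 0 := by
    intro y v hv
    by_cases hy : y ∈ O
    · by_contra hne
      exact (hposO y hy v hne).ne' (hv v)
    · rw [hval_out y hy] at hv
      exact g₀.nondegenerate y v hv
  /- ── smoothness ── -/
  -- the model metric on `D`
  set Dop : Opens E := ⟨D, hD⟩ with hDop
  set gN : PseudoRiemannianMetric 𝓘(ℝ, E) ∞ E (TangentSpace 𝓘(ℝ, E) : Dop → Type _) :=
    riemannianOfRepr Dop P hPs (fun x hx ↦ hPsymm x hx) (fun x hx ↦ hPpos x hx) with hgN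
  set f : Dop → M := fun u ↦ Ψ u with hf
  have hfs : ContMDiffOn 𝓘(ℝ, E) I ∞ f univ := by
    intro u _
    have h1 : ContMDiffAt 𝓘(ℝ, E) I ∞ Ψ (u : E) := hΨs.contMDiffAt (hD.mem_nhds u.2)
    exact (h1.comp u (contMDiff_subtype_val (n := ∞) u)).contMDiffWithinAt
  have hmf : ∀ (u : Dop) (a : E), mfderiv 𝓘(ℝ, E) I f u a = mfderiv 𝓘(ℝ, E) I Ψ u a := by
    intro u a
    have h1 : MDifferentiableAt 𝓘(ℝ, E) I Ψ (u : E) :=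
      (hΨs.contMDiffAt (hD.mem_nhds u.2)).mdifferentiableAt (by simp)
    have h2 : MDifferentiableAt 𝓘(ℝ, E) 𝓘(ℝ, E) (Subtype.val : Dop → E) u :=
      (contMDiff_subtype_val (n := ∞) u).mdifferentiableAt (by simp)
    have h3 : mfderiv 𝓘(ℝ, E) 𝓘(ℝ, E) (Subtype.val : Dop → E) u a = a := by
      have hfun : (Subtype.val : Dop → E) = extChartAt 𝓘(ℝ, E) u := by
        funext z; exact (OpensChart.extChartAt_apply u z).symm
      rw [hfun]; exact OpensChart.mfderiv_extChartAt_apply u a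
    show mfderiv 𝓘(ℝ, E) I (Ψ ∘ Subtype.val) u a = _
    rw [mfderiv_comp u h1 h2]
    show mfderiv 𝓘(ℝ, E) I Ψ u (mfderiv 𝓘(ℝ, E) 𝓘(ℝ, E) (Subtype.val : Dop → E) u a) = _
    rw [h3]
  have hsmooth : ∀ y : M, ContMDiffAt I (I.prod 𝓘(ℝ, E →L[ℝ] E →L[ℝ] ℝ)) ∞
      (fun p : M ↦ TotalSpace.mk' (E →L[ℝ] E →L[ℝ] ℝ)
        (E := fun p : M ↦ TangentSpace I p →L[ℝ] TangentSpace I p →L[ℝ] ℝ) p (val₁ p)) y := by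
    intro y
    by_cases hy : y ∈ O
    · -- inside: descend along `Ψ`
      set x₀ : E := pre y with hx₀
      have hx₀S : x₀ ∈ S := hpreS y hy
      set u₀ : Dop := ⟨x₀, hSD' hx₀S⟩ with hu₀
      have hfu₀ : f u₀ = y := hpreΨ y hy
      have hf' : Injective (mfderiv 𝓘(ℝ, E) I f u₀) := by
        intro a b hab
        rw [hmf, hmf] at hab
        exact hΨd _ (hSD' hx₀S) hab
      have heq : ∀ᶠ u in 𝓝 u₀, pullbackBilin (I := I) (I' := 𝓘(ℝ, E)) f val₁ u = gN.val u := by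
        have hopen : IsOpen ((Subtype.val : Dop → E) ⁻¹' S) := hS.preimage continuous_subtype_val
        filter_upwards [hopen.mem_nhds (show u₀ ∈ (Subtype.val : Dop → E) ⁻¹' S from hx₀S)] with u hu
        ext a b
        rw [pullbackBilin_apply, hmf, hmf, hkeyS _ hu, riemannianOfRepr_val]
        rfl
      have h := contMDiffAt_of_pullbackBilin_eq gN val₁ isOpen_univ (mem_univ u₀) hfs hf' heq
      rwa [hfu₀] at h
    · -- outside: `val₁ = g₀.val` near `y`
      have hev : ∀ᶠ p in 𝓝 y, val₁ p = g₀.val p := by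
        by_cases hyc : y ∈ Ψ '' closure S
        · -- boundary point: `y = Ψ x*`, `x* ∈ closure S ∖ S`
          obtain ⟨xs, hxs, rfl⟩ := hyc
          have hxsD : xs ∈ D := hSD hxs
          have hxsS : xs ∉ S := fun h ↦ hy ⟨xs, h, rfl⟩
          have hxsS' : xs ∉ S' := fun h ↦ hxsS (hS'S h)
          have hloc : IsLocalDiffeomorphAt 𝓘(ℝ, E) I ∞ Ψ xs :=
            isLocalDiffeomorphAt_of_injective hD hxsD hΨs (hΨd xs hxsD)
          set σ := hloc.localInverse with hσ
          have hσy : Ψ xs ∈ σ.source := hloc.localInverse_mem_source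
          have hσxs : σ (Ψ xs) = xs := hloc.localInverse_left_inv hloc.localInverse_mem_target
          have hσc : ContinuousAt σ (Ψ xs) := hloc.localInverse_contMDiffAt.continuousAt
          -- near `y`, the local inverse lands in the open set `D ∖ S'`
          have hopen : IsOpen (D \ S') := hD.sdiff hS'
          have h1 : ∀ᶠ p in 𝓝 (Ψ xs), σ p ∈ D \ S' := by
            have : σ (Ψ xs) ∈ D \ S' := by rw [hσxs]; exact ⟨hxsD, hxsS'⟩
            exact hσc.preimage_mem_nhds (hopen.mem_nhds this)
          have h2 : ∀ᶠ p in 𝓝 (Ψ xs), p ∈ σ.source := σ.open_source.mem_nhds hσy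
          filter_upwards [h1, h2] with p hp1 hp2
          have hp : Ψ (σ p) = p := hloc.localInverse_right_inv hp2
          by_cases hpO : p ∈ O
          · -- `p = Ψ x'` with `x' ∈ S`; injectivity forces `x' = σ p`
            have hx' : pre p = σ p := hΨinj (hSD' (hpreS p hpO)) hp1.1 ((hpreΨ p hpO).trans hp.symm)
            rw [hval_in p hpO, hx', hpush_g₀ _ hp1.1 hp1.2, hp]
          · exact hval_out p hpO
        · -- far from the modified region
          have hclosed : IsClosed (Ψ '' closure S) :=
            (hSc.image_of_continuousOn (hΨs.continuousOn.mono hSD)).isClosed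
          filter_upwards [hclosed.isOpen_compl.mem_nhds hyc] with p hp
          exact hval_out p (fun h ↦ hp (image_mono subset_closure h))
      have hev' : (fun p : M ↦ TotalSpace.mk' (E →L[ℝ] E →L[ℝ] ℝ)
          (E := fun p : M ↦ TangentSpace I p →L[ℝ] TangentSpace I p →L[ℝ] ℝ) p (val₁ p)) =ᶠ[𝓝 y]
          fun p : M ↦ TotalSpace.mk' (E →L[ℝ] E →L[ℝ] ℝ)
            (E := fun p : M ↦ TangentSpace I p →L[ℝ] TangentSpace I p →L[ℝ] ℝ) p (g₀.val p) := by
        filter_upwards [hev] with p hp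
        rw [hp]
      exact (g₀.contMDiff y).congr_of_eventuallyEq hev'
  /- ── the metric ── -/
  refine ⟨{ val := val₁, symm := hsymm, nondegenerate := hnondeg, contMDiff := hsmooth }, hkey,
    fun y hy ↦ hval_out y hy, fun hg₀ y v hv ↦ ?_⟩
  by_cases hy : y ∈ O
  · exact hposO y hy v hv
  · show 0 < val₁ y v v
    rw [hval_out y hy]
    exact hg₀ y v hv

end Literature.Geometry.Riemannian

end
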